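import Summits.HubbardSuperconductivity.HubbardSuperconductivity.Theorems.AnisotropyChordTransferFibre3FinXDCheck

/-!
# Route `AnisotropyChord` / H0 rotor rung: FIN per-`L` row-D (KT-2a″) SUB-CELL facts, `L = 11` (0–5)

Row-D facts `xdCellAny0 11 (49/50) la lb aD = true` on quarter sub-cells of the combined cells whose side condition needs `aD ≈ .04` (mechhunt STATUS p3 g7 REPORT 3).
Prover seat `hubbard-h0-rotor-p3` g7; helper for piece A = stmt-HubbardSuperconductivity-23918 of rung 19089 (`--supports`, helper class).
WHAT THIS IS NOT: nothing here proves superconductivity in the Hubbard model (rotor TARGET as worded stays FALSE, g15 verdict); kernel facts /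
assembly for ONE conditional reduction at one `L`.  No sorry.
-/

set_option linter.dupNamespace false
set_option autoImplicit false

namespace Summit.HubbardSuperconductivity.HubbardSuperconductivity.Theorems.AnisotropyChord.Transfer.Fibre3

namespace FinXD

/-- row-D sub-cell `[13924639293469335, 14011668289053518]` of `L = 11`. [folklore] -/
theorem xd11s_137_0 : xdCellAny0 11 (49/50 : ℚ) 13924639293469335 14011668289053518 (1/25 : ℚ) = true := by decide +kernel

/-- row-D sub-cell `[14011668289053518, 14098697284637702]` of `L = 11`. [folklore] -/
theorem xd11s_137_1 : xdCellAny0 11 (49/50 : ℚ) 14011668289053518 14098697284637702 (1/25 : ℚ) = true := by decide +kernel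

/-- row-D sub-cell `[14098697284637702, 14185726280221885]` of `L = 11`. [folklore] -/
theorem xd11s_137_2 : xdCellAny0 11 (49/50 : ℚ) 14098697284637702 14185726280221885 (1/25 : ℚ) = true := by decide +kernel

/-- row-D sub-cell `[14185726280221885, 14272755275806069]` of `L = 11`. [folklore] -/
theorem xd11s_137_3 : xdCellAny0 11 (49/50 : ℚ) 14185726280221885 14272755275806069 (1/25 : ℚ) = true := by decide +kernel

/-- row-D sub-cell `[14272755275806069, 14361959996279856]` of `L = 11`. [folklore] -/
theorem xd11s_138_0 : xdCellAny0 11 (49/50 : ℚ) 14272755275806069 14361959996279856 (1/25 : ℚ) = true := by decide +kernel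

/-- row-D sub-cell `[14361959996279856, 14451164716753644]` of `L = 11`. [folklore] -/
theorem xd11s_138_1 : xdCellAny0 11 (49/50 : ℚ) 14361959996279856 14451164716753644 (1/25 : ℚ) = true := by decide +kernel

end FinXD

end Summit.HubbardSuperconductivity.HubbardSuperconductivity.Theorems.AnisotropyChord.Transfer.Fibre3
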